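import Summits.BirchSwinnertonDyer.BirchSwinnertonDyer.Theorems.GenusKolyvaginAtTwoKolyvaginRelationAtTwoCharpoly

/-!
# Route `GenusKolyvaginAtTwo`, LINE 6 of crux `KolyvaginExactAtTwo`: Q2 `KolyvaginRelationAtTwo`
# — BOTH local order equalities `ord d_M(mℓ)_λ = ord c_M(mℓ)_λ = ord c_M(m)_λ` at every prime `p`
# (including `2`) from the reduction datum (helper, PROVED; seat `bsd-line-gk2-p2` g5)

Sequel to `Theorems/GenusKolyvaginAtTwoKolyvaginRelationAtTwoCharpoly.lean` (same seat), which proves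
the COMPOSITE relation «`k c_M(mℓ)` Selmer at `λ` iff `k c_M(m)_λ = 0`» (McCallum Prop. 4.4 /
Gross Prop. 6.2 (2) in order form) at every `p` from an abstract reduction datum at `λ`, via the
eigenspace-free `ker χ_ℓ = p^M Ẽ(𝔽_λ)`. Item Q2 (stmt-BirchSwinnertonDyer-24880) is typed as the
CONJUNCTION of the two printed equalities `ord d_M(mℓ)_λ = ord c_M(mℓ)_λ` and
`ord c_M(mℓ)_λ = ord c_M(m)_λ`; this file proves both from the same datum plus two more displayed
facts of the intended instantiation:

* `hFA₁` — every arithmetic Frobenius `F` at `𝔓 ∣ λ` acts on `E(K_{mℓ})` through `⟨σ_ℓ⟩` (the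
  decomposition group of `λ_{mℓ}` in `Gal(K_{mℓ}/K)` is the inertia group `G_ℓ`: `λ = (ℓ)` splits
  completely in `K_m` and `λ_m` ramifies totally in `K_{mℓ}`; McCallum §4 p. 301, Gross §3);
* `hP₁red` — `P̃_{mℓ} = t · φ(P̃_m)` for some integer `t` (indeed `t = ℓ(ℓ+1)/2`:
  `P_{mℓ} = Σ_S σ D_m D_ℓ y_{mℓ}`, `σ_ℓ` acts trivially mod `λ_{mℓ}`, so `D_ℓ ≡ Σ_{i=1}^{ℓ} i`, and
  `y_{mℓ} ≡ Frob · y_m` (Gross Prop. 3.7 (2)) — the same congruence that produces the Euler-system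
  root relation `red R₀ = l' φ(P̃_m) − a' P̃_m` of the datum).

* §5 FIRST EQUALITY `…mem_torsionLocalKer_iff_mem_selmerLocalKer_of_charpoly`: `k c(P_{mℓ})_λ = 0` iff
  `k c(P_{mℓ})` is Selmer at `λ` — an unramified class vanishes at `λ` iff its cocycle vanishes at
  `F` (Gross Prop. 9.6, tree `mem_torsionLocalKer_iff_h1Eval_eq_zero`); the value
  `k(FQ₁ − Q₁) − k·Σ_{j<i} σ_ℓ^j R₀` (`p^M Q₁ = P_{mℓ}`) reduces to `φ²(kQ̃₁) − kQ̃₁ − i·k·red R₀`,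
  `k·red R₀ = 0` IS the Selmer condition, and `φ²` fixes `kQ̃₁` since `p^M·kQ̃₁ = t φ(k P̃_m)` with
  `k P̃_m ∈ p^M Ẽ(𝔽_λ)` by the composite relation. AT `p = 2` NO EXTRA DEPTH `2^{M+1} ∣ ℓ + 1` IS
  NEEDED (the g2 memo's worry «Prop. 4.4 (1) ports one level deeper» is dissolved). SECOND EQUALITY
  `…mem_torsionLocalKer_iff_mem_torsionLocalKer_of_charpoly` = first + composite.
* §6 `zsmul_kolyvaginClass_localOrders_of_zhangKolyvaginPrime` — both at a Kolyvagin prime in Zhang's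
  currency (place, Frobenius fixing `E[p^M]`, torsion comparison from the tree);
  `kolyvaginRelationAtTwo_of_datum` — `p = 2`, conclusion VERBATIM that of Q2 for the classes
  `d.kolyvaginClass Nat.prime_two M` of `KolyvaginHeegnerData` (given `λ ∋ ℓ`, `j`), from: Zhang-form
  prime with `M ≤ M(ℓ)`, admissibility of `E(K[m]), E(K[mℓ])` for `2^M` with invariant `[P(·)]`,
  `c_M(m)` Selmer at `λ`, good reduction at `ℓ`, and the datum.

HONEST FRAMING. Q2 is NOT closed: what remains displayed (`hdata`, admissibility, the Selmer
condition of `c_M(m)` at `λ`) is the arithmetic-geometric instantiation for Heegner points —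
reduction of `E(K̄)` modulo `𝔓 ∣ λ`, Gross Prop. 3.7 (2), Lemma 4.3, Prop. 3.6, Prop. 6.2 (1) — which
the tree does not hold at any prime (it is why the odd-`p` statement is the unproved named fact
`McCallum1991.prop44_localOrder_kolyvaginClass_mul_eq`). The `p = 2` content of Q2 («the bet») is
settled: no parity, sign-of-`Δ`, depth or Frobenius-class hypothesis enters. BSD is not proved by this.

References: [McCallumLMS1991] §4; [GrossLMS1991] §3, 3.7, 6.2, 9.6; [WZhang2014] (xii); [SilvermanAEC2009] V.2.3.1.
-/

set_option autoImplicit false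
set_option linter.dupNamespace false

noncomputable section
open scoped Classical

namespace Summit.BirchSwinnertonDyer.BirchSwinnertonDyer.Theorems.GenusExact

open WeierstrassCurve NumberField IsDedekindDomain Field Finset
open Literature.NumberTheory.GaloisRepresentations Literature.NumberTheory.EllipticCurves
open Literature.NumberTheory.EllipticCurves.KolyvaginCocycle

universe u
/-! ### §5 The first conjunct of Q2: `ord d_M(mℓ)_λ = ord c_M(mℓ)_λ` from the datum -/

section Orders

variable {K : Type u} [Field K] [NumberField K] (W : WeierstrassCurve K) [W.IsElliptic]

set_option maxHeartbeats 800000 in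
/-- **McCallum 1991 Prop. 4.4 «in particular», first equality `ord d_M(mℓ)_λ = ord c_M(mℓ)_λ`, at
every prime `p` (including `2`), from the reduction datum at `λ`.** Setting of
`zsmul_kolyvaginClass_mem_selmerLocalKer_iff_mem_torsionLocalKer_of_charpoly`, plus `hFA₁` (the
chosen Frobenius acts on `A₁ = E(K_{mℓ})` through `⟨σ_ℓ⟩`) and `hP₁red` (`P̃_{mℓ} = t·φ(P̃_m)`).
Conclusion: for every `k`, `k c(P₁)_λ = 0` in `H¹(K_λ, E[p^M])` iff `k c(P₁)` satisfies the Selmer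
condition at `λ`. Proof: Gross Prop. 9.6 at `F` for the unramified class; the cocycle value
`k(FQ₁ − Q₁) − kΣ_{j<i}σ^jR₀` is `p^M`-torsion with reduction `φ²(kQ̃₁) − kQ̃₁ − i(k·red R₀) = 0`.
[cite: McCallumLMS1991, Prop. 4.4] [cite: GrossLMS1991, Prop. 6.2 (2), Prop. 9.6] -/
theorem zsmul_kolyvaginClass_mem_torsionLocalKer_iff_mem_selmerLocalKer_of_charpoly
    {p : ℕ} (hp : p.Prime) {M : ℕ}
    {hdiv : ∀ P : geomPoints W, ∃ Q : geomPoints W, ((p ^ M : ℕ) : ℤ) • Q = P}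
    {A₁ A₂ : AddSubgroup (geomPoints W)}
    (hA₁ : IsAdmissible (absoluteGaloisGroup K) A₁ ((p ^ M : ℕ) : ℤ))
    (hA₂ : IsAdmissible (absoluteGaloisGroup K) A₂ ((p ^ M : ℕ) : ℤ))
    {P₁ P₂ : geomPoints W}
    (hP₁ : P₁ ∈ invPoints (absoluteGaloisGroup K) A₁ ((p ^ M : ℕ) : ℤ))
    (hP₂ : P₂ ∈ invPoints (absoluteGaloisGroup K) A₂ ((p ^ M : ℕ) : ℤ))
    -- the place `λ`
    {v : HeightOneSpectrum (𝓞 K)} (hgood : W.HasGoodReductionAt v) (hpv : (p : 𝓞 K) ∉ v.asIdeal)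
    {𝔐 : Ideal (HeightOneSpectrum.localAbsIntegers v)} (h𝔐 : 𝔐 ∈ v.localPrimesAbove)
    {F : absoluteGaloisGroup K}
    (hF : IsArithFrobAt (𝓞 K) F (v.primeBelow (closureEmb (K := K) (v.adicCompletion K)) 𝔐))
    (hFfix : F ∈ torsionFixing W ((p ^ M : ℕ) : ℤ))
    (hsurj : Function.Surjective (torsionPointsMap W (v.adicCompletion K) ((p ^ M : ℕ) : ℤ)))
    -- the reduction datum at `𝔓`
    {B : Type*} [AddCommGroup B] (red : geomPoints W →+ B) (φ : B →+ B)
    (hredI : ∀ τ ∈ (v.primeBelow (closureEmb (K := K) (v.adicCompletion K)) 𝔐).inertia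
      (absoluteGaloisGroup K), ∀ x : geomPoints W, red (τ • x) = red x)
    (hredF : ∀ x : geomPoints W, red (F • x) = φ (φ (red x)))
    (hred : ∀ x : geomPoints W, ((p ^ M : ℕ) : ℤ) • x = 0 → red x = 0 → x = 0)
    -- the arithmetic of `B = Ẽ(\bar F_ℓ)`: Frobenius equation and divisibility
    {ℓ : ℕ} {a l' a' : ℤ} (hl' : ((ℓ + 1 : ℕ) : ℤ) = (p : ℤ) ^ M * l')
    (ha' : a = (p : ℤ) ^ M * a')
    (hcharB : ∀ b : B, φ (φ b) + (ℓ : ℤ) • b = a • φ b)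
    (hdivB : ∀ b : B, ∃ y : B, ((p ^ M : ℕ) : ℤ) • y = b)
    -- the Euler-system data at `λ`
    {τ₀ : absoluteGaloisGroup K}
    (hτ₀ : τ₀ ∈ (v.primeBelow (closureEmb (K := K) (v.adicCompletion K)) 𝔐).inertia
      (absoluteGaloisGroup K))
    (hIτ₀ : ∀ τ ∈ (v.primeBelow (closureEmb (K := K) (v.adicCompletion K)) 𝔐).inertia
      (absoluteGaloisGroup K), ∃ i : ℕ, ∀ x ∈ A₁, τ • x = (τ₀ ^ i) • x)
    (hFA₁ : ∃ i : ℕ, ∀ x ∈ A₁, F • x = (τ₀ ^ i) • x)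
    {R₀ : geomPoints W} (hR₀A : R₀ ∈ A₁) (hR₀ : ((p ^ M : ℕ) : ℤ) • R₀ = τ₀ • P₁ - P₁)
    (hR₀red : red R₀ = l' • φ (red P₂) - a' • red P₂)
    {t : ℤ} (hP₁red : red P₁ = t • φ (red P₂))
    (hFP₂ : F • P₂ = P₂)
    (hsel₂ : kolyvaginClass W _ hdiv hA₂ P₂ hP₂ ∈
      selmerLocalKer W (v.adicCompletion K) ((p ^ M : ℕ) : ℤ))
    (k : ℤ) :
    k • kolyvaginClass W _ hdiv hA₁ P₁ hP₁ ∈ W.torsionLocalKer (v.adicCompletion K) ((p ^ M : ℕ) : ℤ) ↔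
      k • kolyvaginClass W _ hdiv hA₁ P₁ hP₁ ∈
        selmerLocalKer W (v.adicCompletion K) ((p ^ M : ℕ) : ℤ) := by
  set ι₀ := closureEmb (K := K) (v.adicCompletion K) with hι₀
  set 𝔓 := v.primeBelow ι₀ 𝔐 with h𝔓def
  have h𝔓 : 𝔓 ∈ v.primesAbove := HeightOneSpectrum.primeBelow_mem_primesAbove h𝔐
  have hnZ : ((p ^ M : ℕ) : ℤ) = (p : ℤ) ^ M := by push_cast; rfl
  have hn0 : ((p ^ M : ℕ) : ℤ) ≠ 0 := by exact_mod_cast pow_ne_zero M hp.ne_zero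
  have hnv : ((((p ^ M : ℕ) : ℤ)) : 𝓞 K) ∉ v.asIdeal := by
    rw [Int.cast_natCast, Nat.cast_pow]
    exact fun h ↦ hpv (v.isPrime.mem_of_pow_mem M h)
  have hl1 : ((ℓ : ℤ) + 1) = (p : ℤ) ^ M * l' := by exact_mod_cast hl'
  -- `φ² = 1` on `B[p^M]`
  have hBn : ∀ b : B, ((p ^ M : ℕ) : ℤ) • b = 0 → φ (φ b) = b := fun b hb ↦ by
    rw [hnZ] at hb
    have h := hcharB b
    have h1 : a • φ b = 0 := by rw [ha', mul_comm, mul_smul, ← map_zsmul, hb, map_zero, smul_zero]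
    have h2 : (ℓ : ℤ) • b = -b := by
      rw [show (ℓ : ℤ) = (p : ℤ) ^ M * l' - 1 by rw [← hl1]; ring, sub_smul, one_smul, mul_comm,
        mul_smul, hb, smul_zero, zero_sub]
    rw [h1, h2, ← sub_eq_add_neg, sub_eq_zero] at h
    exact h
  refine ⟨fun h ↦ W.torsionLocalKer_le_selmerLocalKer (v.adicCompletion K) _ h, fun hsel₁ ↦ ?_⟩
  -- ### (a) the Selmer condition at `λ` gives `k · red R₀ = 0`
  have hroot : rootIn A₁ ((p ^ M : ℕ) : ℤ) (τ₀ • P₁ - P₁) = R₀ :=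
    rootIn_eq hA₁.eq_zero_of_zsmul hR₀A hR₀
  have hkR₀ : k • red R₀ = 0 := by
    have h := (zsmul_kolyvaginClass_mem_selmerLocalKer_iff_of_red W hA₁ hP₁ hgood hnv h𝔓 red hredI
      hred k).mp hsel₁ τ₀ hτ₀
    rwa [hroot] at h
  -- ### (b) the composite relation: `k c(P₂)_λ = 0`, i.e. `k P̃₂ = p^M b` with `φ² b = b`
  have hcomp := (zsmul_kolyvaginClass_mem_selmerLocalKer_iff_mem_torsionLocalKer_of_charpoly W hp
    hA₁ hA₂ hP₁ hP₂ hgood hpv h𝔐 hF hFfix hsurj red φ hredI hredF hred hl' ha' hcharB hdivB hτ₀ hIτ₀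
    hR₀A hR₀ hR₀red hFP₂ hsel₂ k).mp hsel₁
  obtain ⟨b, hb, hkb⟩ := (zsmul_kolyvaginClass_mem_torsionLocalKer_iff_of_red W hA₂ hP₂ hgood hnv
    hn0 h𝔐 hF hFfix hsurj hsel₂ hFP₂ red (φ.comp φ) (fun x ↦ hredF x) hred (fun b hb ↦ hBn b hb)
    k).mp hcomp
  have hb' : φ (φ b) = b := hb
  -- ### (c) Gross Prop. 9.6 at `F` for the unramified class `k c(P₁)`
  have hvbad : v ∉ W.badPlaces (𝓞 K) := fun h ↦ h hgood
  obtain ⟨Q, hQ⟩ := hdiv P₁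
  have hunr : k • kolyvaginClass W _ hdiv hA₁ P₁ hP₁ ∈
      unramifiedKer (geomTorsion W ((p ^ M : ℕ) : ℤ)) 𝔓 := by
    rw [← W.selmerLocalKer_eq_unramifiedKer hgood hnv h𝔓]
    exact hsel₁
  have hcrit := mem_torsionLocalKer_iff_h1Eval_eq_zero W ((p ^ M : ℕ) : ℤ) h𝔐 hF hFfix
    (inertia_le_torsionFixing W hvbad hnv ι₀ h𝔐) (isOpen_torsionFixing W hn0) hsurj hunr
  rw [hcrit, h1Eval_zsmul W _ k _ hFfix, kolyvaginClass_eq_cls hA₁ hP₁ hQ]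
  unfold KolyvaginCocycle.cls
  rw [h1Eval_oneCocycleClass W _ _ hFfix, Subtype.ext_iff]
  change ((k • (F • Q - Q - rootIn A₁ ((p ^ M : ℕ) : ℤ) (F • P₁ - P₁)) : geomPoints W)) = 0
  -- `F` acts on `A₁` as `τ₀^i`
  obtain ⟨i, hi⟩ := hFA₁
  have hrootF : rootIn A₁ ((p ^ M : ℕ) : ℤ) (F • P₁ - P₁) = ∑ j ∈ range i, τ₀ ^ j • R₀ := by
    rw [hi P₁ hP₁.1, rootIn_pow_smul_sub hA₁ hP₁ τ₀ i, hroot]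
  -- `φ²` fixes `k Q̃₁`
  have hφφkQ : φ (φ (k • red Q)) = k • red Q := by
    have hz : φ (φ (k • red Q - t • φ b)) = k • red Q - t • φ b := by
      refine hBn _ ?_
      have e1 : ((p ^ M : ℕ) : ℤ) • (k • red Q) = t • (k • φ (red P₂)) := by
        rw [smul_comm, ← map_zsmul red, hQ, hP₁red, smul_comm]
      have e2 : ((p ^ M : ℕ) : ℤ) • (t • φ b) = t • (k • φ (red P₂)) := by
        rw [smul_comm, ← map_zsmul φ, ← hkb, map_zsmul]
      rw [zsmul_sub, e1, e2, sub_self]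
    have h1 : k • red Q = (k • red Q - t • φ b) + t • φ b := by abel
    calc φ (φ (k • red Q)) = φ (φ ((k • red Q - t • φ b) + t • φ b)) := by rw [← h1]
      _ = φ (φ (k • red Q - t • φ b)) + t • φ (φ (φ b)) := by
          rw [map_add, map_add, map_zsmul, map_zsmul]
      _ = k • red Q := by rw [hz, hb', sub_add_cancel]
  refine hred _ ?_ ?_
  · -- the value is `p^M`-torsion
    have hn' : ((p ^ M : ℕ) : ℤ) • (F • Q - Q - rootIn A₁ ((p ^ M : ℕ) : ℤ) (F • P₁ - P₁)) = 0 :=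
      (mem_torsionBy_iff' ((p ^ M : ℕ) : ℤ) _).mp (smul_sub_sub_rootIn_mem hP₁ hQ F)
    rw [smul_comm, hn', zsmul_zero]
  · -- its reduction vanishes
    rw [map_zsmul, map_sub, map_sub, hrootF, map_sum,
      sum_congr rfl fun j _ ↦ hredI _ (pow_mem hτ₀ j) R₀, sum_const, card_range, hredF,
      zsmul_sub, zsmul_sub, ← map_zsmul φ, ← map_zsmul φ, hφφkQ, sub_self, zero_sub, neg_eq_zero,
      ← natCast_zsmul, zsmul_comm, hkR₀, zsmul_zero]

/-- **McCallum 1991 Prop. 4.4 «in particular», second equality `ord c_M(mℓ)_λ = ord c_M(m)_λ`, at every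
prime `p`, from the datum**: `k c(P_{mℓ})_λ = 0` iff `k c(P_m)_λ = 0`. [cite: McCallumLMS1991, Prop. 4.4] -/
theorem zsmul_kolyvaginClass_mem_torsionLocalKer_iff_mem_torsionLocalKer_of_charpoly
    {p : ℕ} (hp : p.Prime) {M : ℕ}
    {hdiv : ∀ P : geomPoints W, ∃ Q : geomPoints W, ((p ^ M : ℕ) : ℤ) • Q = P}
    {A₁ A₂ : AddSubgroup (geomPoints W)}
    (hA₁ : IsAdmissible (absoluteGaloisGroup K) A₁ ((p ^ M : ℕ) : ℤ))
    (hA₂ : IsAdmissible (absoluteGaloisGroup K) A₂ ((p ^ M : ℕ) : ℤ))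
    {P₁ P₂ : geomPoints W}
    (hP₁ : P₁ ∈ invPoints (absoluteGaloisGroup K) A₁ ((p ^ M : ℕ) : ℤ))
    (hP₂ : P₂ ∈ invPoints (absoluteGaloisGroup K) A₂ ((p ^ M : ℕ) : ℤ))
    {v : HeightOneSpectrum (𝓞 K)} (hgood : W.HasGoodReductionAt v) (hpv : (p : 𝓞 K) ∉ v.asIdeal)
    {𝔐 : Ideal (HeightOneSpectrum.localAbsIntegers v)} (h𝔐 : 𝔐 ∈ v.localPrimesAbove)
    {F : absoluteGaloisGroup K}
    (hF : IsArithFrobAt (𝓞 K) F (v.primeBelow (closureEmb (K := K) (v.adicCompletion K)) 𝔐))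
    (hFfix : F ∈ torsionFixing W ((p ^ M : ℕ) : ℤ))
    (hsurj : Function.Surjective (torsionPointsMap W (v.adicCompletion K) ((p ^ M : ℕ) : ℤ)))
    {B : Type*} [AddCommGroup B] (red : geomPoints W →+ B) (φ : B →+ B)
    (hredI : ∀ τ ∈ (v.primeBelow (closureEmb (K := K) (v.adicCompletion K)) 𝔐).inertia
      (absoluteGaloisGroup K), ∀ x : geomPoints W, red (τ • x) = red x)
    (hredF : ∀ x : geomPoints W, red (F • x) = φ (φ (red x)))
    (hred : ∀ x : geomPoints W, ((p ^ M : ℕ) : ℤ) • x = 0 → red x = 0 → x = 0)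
    {ℓ : ℕ} {a l' a' : ℤ} (hl' : ((ℓ + 1 : ℕ) : ℤ) = (p : ℤ) ^ M * l')
    (ha' : a = (p : ℤ) ^ M * a')
    (hcharB : ∀ b : B, φ (φ b) + (ℓ : ℤ) • b = a • φ b)
    (hdivB : ∀ b : B, ∃ y : B, ((p ^ M : ℕ) : ℤ) • y = b)
    {τ₀ : absoluteGaloisGroup K}
    (hτ₀ : τ₀ ∈ (v.primeBelow (closureEmb (K := K) (v.adicCompletion K)) 𝔐).inertia
      (absoluteGaloisGroup K))
    (hIτ₀ : ∀ τ ∈ (v.primeBelow (closureEmb (K := K) (v.adicCompletion K)) 𝔐).inertia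
      (absoluteGaloisGroup K), ∃ i : ℕ, ∀ x ∈ A₁, τ • x = (τ₀ ^ i) • x)
    (hFA₁ : ∃ i : ℕ, ∀ x ∈ A₁, F • x = (τ₀ ^ i) • x)
    {R₀ : geomPoints W} (hR₀A : R₀ ∈ A₁) (hR₀ : ((p ^ M : ℕ) : ℤ) • R₀ = τ₀ • P₁ - P₁)
    (hR₀red : red R₀ = l' • φ (red P₂) - a' • red P₂)
    {t : ℤ} (hP₁red : red P₁ = t • φ (red P₂))
    (hFP₂ : F • P₂ = P₂)
    (hsel₂ : kolyvaginClass W _ hdiv hA₂ P₂ hP₂ ∈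
      selmerLocalKer W (v.adicCompletion K) ((p ^ M : ℕ) : ℤ))
    (k : ℤ) :
    k • kolyvaginClass W _ hdiv hA₁ P₁ hP₁ ∈ W.torsionLocalKer (v.adicCompletion K) ((p ^ M : ℕ) : ℤ) ↔
      k • kolyvaginClass W _ hdiv hA₂ P₂ hP₂ ∈
        W.torsionLocalKer (v.adicCompletion K) ((p ^ M : ℕ) : ℤ) := by
  rw [zsmul_kolyvaginClass_mem_torsionLocalKer_iff_mem_selmerLocalKer_of_charpoly W hp hA₁ hA₂ hP₁
    hP₂ hgood hpv h𝔐 hF hFfix hsurj red φ hredI hredF hred hl' ha' hcharB hdivB hτ₀ hIτ₀ hFA₁ hR₀A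
    hR₀ hR₀red hP₁red hFP₂ hsel₂ k]
  exact zsmul_kolyvaginClass_mem_selmerLocalKer_iff_mem_torsionLocalKer_of_charpoly W hp hA₁ hA₂
    hP₁ hP₂ hgood hpv h𝔐 hF hFfix hsurj red φ hredI hredF hred hl' ha' hcharB hdivB hτ₀ hIτ₀ hR₀A
    hR₀ hR₀red hFP₂ hsel₂ k

end Orders
/-! ### §6 Both conjuncts of Q2 at a Kolyvagin prime in Zhang's currency; the `p = 2` item shape -/

section ZhangOrders

variable {K : Type u} [Field K] [NumberField K] (W : WeierstrassCurve ℚ)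

/-- **Both equalities `ord d_M(mℓ)_λ = ord c_M(mℓ)_λ = ord c_M(m)_λ` at a Kolyvagin prime `ℓ` with
`M ≤ M(ℓ)` in Zhang's currency, any prime `p` (including `2`), granted the reduction datum modulo
the primes `𝔓 ∣ λ`** (as in `zsmul_kolyvaginClass_mem_selmerLocalKer_iff_of_zhangKolyvaginPrime`,
the datum also recording `hFA₁` and `hP₁red`). [cite: McCallumLMS1991, Prop. 4.4]
[cite: GrossLMS1991, Prop. 6.2 (2)] [cite: WZhang2014, Notations (xii)] -/
theorem zsmul_kolyvaginClass_localOrders_of_zhangKolyvaginPrime [W.IsElliptic]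
    [W.IsGloballyMinimal] (hK : IsImaginaryQuadratic K) {N p : ℕ} [Fact p.Prime] {M ℓ : ℕ}
    (hℓ : Zhang2014.IsKolyvaginPrime N W K p ℓ) (hM : M ≤ Zhang2014.kolyvaginIndex W p ℓ)
    {v₀ : HeightOneSpectrum (𝓞 ℚ)} (hℓv₀ : (ℓ : 𝓞 ℚ) ∈ v₀.asIdeal) (hgood₀ : W.HasGoodReductionAt v₀)
    {v : HeightOneSpectrum (𝓞 K)} (hv : (ℓ : 𝓞 K) ∈ v.asIdeal)
    (hgood : (W.baseChange K).HasGoodReductionAt v)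
    {hdiv : ∀ P : geomPoints (W.baseChange K), ∃ Q : geomPoints (W.baseChange K),
      ((p ^ M : ℕ) : ℤ) • Q = P}
    {A₁ A₂ : AddSubgroup (geomPoints (W.baseChange K))}
    (hA₁ : IsAdmissible (absoluteGaloisGroup K) A₁ ((p ^ M : ℕ) : ℤ))
    (hA₂ : IsAdmissible (absoluteGaloisGroup K) A₂ ((p ^ M : ℕ) : ℤ))
    {P₁ P₂ : geomPoints (W.baseChange K)}
    (hP₁ : P₁ ∈ invPoints (absoluteGaloisGroup K) A₁ ((p ^ M : ℕ) : ℤ))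
    (hP₂ : P₂ ∈ invPoints (absoluteGaloisGroup K) A₂ ((p ^ M : ℕ) : ℤ))
    (hsel₂ : kolyvaginClass (W.baseChange K) _ hdiv hA₂ P₂ hP₂ ∈
      selmerLocalKer (W.baseChange K) (v.adicCompletion K) ((p ^ M : ℕ) : ℤ))
    {a l' a' : ℤ} (hl' : ((ℓ + 1 : ℕ) : ℤ) = (p : ℤ) ^ M * l') (ha' : a = (p : ℤ) ^ M * a')
    (hdata : ∀ 𝔓 ∈ v.primesAbove, ∀ F : absoluteGaloisGroup K, IsArithFrobAt (𝓞 K) F 𝔓 →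
      F ∈ torsionFixing (W.baseChange K) ((p ^ M : ℕ) : ℤ) →
      F • P₂ = P₂ ∧
      ∃ (B : Type u) (_ : AddCommGroup B) (red : geomPoints (W.baseChange K) →+ B) (φ : B →+ B)
        (τ₀ : absoluteGaloisGroup K) (R₀ : geomPoints (W.baseChange K)) (t : ℤ),
        (∀ τ ∈ 𝔓.inertia (absoluteGaloisGroup K), ∀ x : geomPoints (W.baseChange K),
          red (τ • x) = red x) ∧
        (∀ x : geomPoints (W.baseChange K), red (F • x) = φ (φ (red x))) ∧
        (∀ x : geomPoints (W.baseChange K), ((p ^ M : ℕ) : ℤ) • x = 0 → red x = 0 → x = 0) ∧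
        (∀ b : B, φ (φ b) + (ℓ : ℤ) • b = a • φ b) ∧
        (∀ b : B, ∃ y : B, ((p ^ M : ℕ) : ℤ) • y = b) ∧
        τ₀ ∈ 𝔓.inertia (absoluteGaloisGroup K) ∧
        (∀ τ ∈ 𝔓.inertia (absoluteGaloisGroup K), ∃ i : ℕ, ∀ x ∈ A₁, τ • x = (τ₀ ^ i) • x) ∧
        (∃ i : ℕ, ∀ x ∈ A₁, F • x = (τ₀ ^ i) • x) ∧
        R₀ ∈ A₁ ∧ ((p ^ M : ℕ) : ℤ) • R₀ = τ₀ • P₁ - P₁ ∧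
        red R₀ = l' • φ (red P₂) - a' • red P₂ ∧
        red P₁ = t • φ (red P₂))
    (k : ℤ) :
    (k • kolyvaginClass (W.baseChange K) _ hdiv hA₁ P₁ hP₁ ∈
          selmerLocalKer (W.baseChange K) (v.adicCompletion K) ((p ^ M : ℕ) : ℤ) ↔
        k • kolyvaginClass (W.baseChange K) _ hdiv hA₁ P₁ hP₁ ∈
          (W.baseChange K).torsionLocalKer (v.adicCompletion K) ((p ^ M : ℕ) : ℤ)) ∧
      (k • kolyvaginClass (W.baseChange K) _ hdiv hA₁ P₁ hP₁ ∈
          (W.baseChange K).torsionLocalKer (v.adicCompletion K) ((p ^ M : ℕ) : ℤ) ↔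
        k • kolyvaginClass (W.baseChange K) _ hdiv hA₂ P₂ hP₂ ∈
          (W.baseChange K).torsionLocalKer (v.adicCompletion K) ((p ^ M : ℕ) : ℤ)) := by
  have hp : p.Prime := Fact.out
  haveI : CharZero (v.adicCompletion K) :=
    charZero_of_injective_algebraMap (algebraMap K (v.adicCompletion K)).injective
  have hq0 : p ^ M ≠ 0 := pow_ne_zero M hp.ne_zero
  have hpv : (p : 𝓞 K) ∉ v.asIdeal := not_natCast_mem_of_prime_ne hℓ.1 hp hℓ.2.2.2.1 _ hv
  obtain ⟨𝔐, h𝔐⟩ := v.localPrimesAbove_nonempty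
  have h𝔓 : v.primeBelow (closureEmb (K := K) (v.adicCompletion K)) 𝔐 ∈ v.primesAbove :=
    HeightOneSpectrum.primeBelow_mem_primesAbove h𝔐
  obtain ⟨F, hF, hFfix⟩ :=
    exists_isArithFrobAt_mem_torsionFixing_of_le_kolyvaginIndex W hK hℓ hM hℓv₀ hgood₀ hv h𝔓
  obtain ⟨hFP₂, B, _, red, φ, τ₀, R₀, t, hredI, hredF, hred, hcharB, hdivB, hτ₀, hIτ₀, hFA₁, hR₀A,
    hR₀, hR₀red, hP₁red⟩ := hdata _ h𝔓 F hF hFfix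
  have hsurj := (torsionPointsMap_bijective (W.baseChange K) (v.adicCompletion K) hq0).2
  exact ⟨(zsmul_kolyvaginClass_mem_torsionLocalKer_iff_mem_selmerLocalKer_of_charpoly
      (W.baseChange K) hp hA₁ hA₂ hP₁ hP₂ hgood hpv h𝔐 hF hFfix hsurj red φ hredI hredF hred hl' ha'
      hcharB hdivB hτ₀ hIτ₀ hFA₁ hR₀A hR₀ hR₀red hP₁red hFP₂ hsel₂ k).symm,
    zsmul_kolyvaginClass_mem_torsionLocalKer_iff_mem_torsionLocalKer_of_charpoly (W.baseChange K)
      hp hA₁ hA₂ hP₁ hP₂ hgood hpv h𝔐 hF hFfix hsurj red φ hredI hredF hred hl' ha' hcharB hdivB hτ₀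
      hIτ₀ hFA₁ hR₀A hR₀ hR₀red hP₁red hFP₂ hsel₂ k⟩

end ZhangOrders
section AtTwoOrders

variable {K : Type} [Field K] [NumberField K] (W : WeierstrassCurve ℚ)

/-- **Q2 `KolyvaginRelationAtTwo` (stmt-BirchSwinnertonDyer-24880) — ITS CONCLUSION VERBATIM (for
a given place `λ ∋ ℓ` and exponent `j`), at `p = 2`, for the tree's classes
`c_M(n) = d.kolyvaginClass Nat.prime_two M` of `KolyvaginHeegnerData`, FROM THE REDUCTION DATUM.**
Hypotheses as in `kolyvaginRelationAtTwo_composite_of_datum` (Zhang-form Kolyvagin prime at `2`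
with `M ≤ M(ℓ)`, admissibility of `E(K[m]), E(K[mℓ]) ⊆ E(K̄)` for `2^M` with `[P(m)]`, `[P(mℓ)]`
invariant mod `2^M`, `c_M(m)` Selmer at `λ`, good reduction at `ℓ`), the datum `hdata` modulo the
primes `𝔓 ∣ λ` additionally recording that every Frobenius at `𝔓` acts on `E(K[mℓ])` through
`⟨σ_ℓ⟩` and that `P̃(mℓ)` is a multiple of `φ(P̃(m))`. Conclusion: the two conjuncts of Q2 —
(`2^j c_M(mℓ)` Selmer at `λ` iff `2^j c_M(mℓ)_λ = 0`) ∧ (`2^j c_M(mℓ)_λ = 0` iff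
`2^j c_M(m)_λ = 0`). No parity, sign-of-`Δ` or Frobenius-class condition at `2` is needed; what is
displayed (and not in the tree at any `p`) is the arithmetic-geometric instantiation of the datum.
BSD is not proved by this; Q2 is not closed by this. [cite: McCallumLMS1991, Prop. 4.4]
[cite: GrossLMS1991, Prop. 6.2 (2)] -/
theorem kolyvaginRelationAtTwo_of_datum [W.IsElliptic] [W.IsGloballyMinimal]
    (hK : IsImaginaryQuadratic K) {N : ℕ} [NeZero N] {N' : ℕ}
    {Dt : Literature.NumberTheory.EllipticCurves.ModularForms.ModularParametrizationData W N}
    {β : ℤ} {ι : K →+* ℂ} {M m l : ℕ}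
    (hℓ : Zhang2014.IsKolyvaginPrime N' W K 2 l) (hM : M ≤ Zhang2014.kolyvaginIndex W 2 l)
    (d : KolyvaginHeegnerData Dt β ι m) (d' : KolyvaginHeegnerData Dt β ι (m * l))
    (hA : IsAdmissible (absoluteGaloisGroup K) d.pointsSubgroup ((2 ^ M : ℕ) : ℤ))
    (hP : d.toGeomPoints d.derivedPoint ∈
      invPoints (absoluteGaloisGroup K) d.pointsSubgroup ((2 ^ M : ℕ) : ℤ))
    (hA' : IsAdmissible (absoluteGaloisGroup K) d'.pointsSubgroup ((2 ^ M : ℕ) : ℤ))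
    (hP' : d'.toGeomPoints d'.derivedPoint ∈
      invPoints (absoluteGaloisGroup K) d'.pointsSubgroup ((2 ^ M : ℕ) : ℤ))
    {v₀ : HeightOneSpectrum (𝓞 ℚ)} (hℓv₀ : (l : 𝓞 ℚ) ∈ v₀.asIdeal) (hgood₀ : W.HasGoodReductionAt v₀)
    {v : HeightOneSpectrum (𝓞 K)} (hv : (l : 𝓞 K) ∈ v.asIdeal)
    (hgood : (W.baseChange K).HasGoodReductionAt v)
    (hsel : d.kolyvaginClass Nat.prime_two M ∈
      selmerLocalKer (W.baseChange K) (v.adicCompletion K) ((2 ^ M : ℕ) : ℤ))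
    {a l' a' : ℤ} (hl' : ((l + 1 : ℕ) : ℤ) = (2 : ℤ) ^ M * l') (ha' : a = (2 : ℤ) ^ M * a')
    (hdata : ∀ 𝔓 ∈ v.primesAbove, ∀ F : absoluteGaloisGroup K, IsArithFrobAt (𝓞 K) F 𝔓 →
      F ∈ torsionFixing (W.baseChange K) ((2 ^ M : ℕ) : ℤ) →
      F • d.toGeomPoints d.derivedPoint = d.toGeomPoints d.derivedPoint ∧
      ∃ (B : Type) (_ : AddCommGroup B) (red : geomPoints (W.baseChange K) →+ B) (φ : B →+ B)
        (τ₀ : absoluteGaloisGroup K) (R₀ : geomPoints (W.baseChange K)) (t : ℤ),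
        (∀ τ ∈ 𝔓.inertia (absoluteGaloisGroup K), ∀ x : geomPoints (W.baseChange K),
          red (τ • x) = red x) ∧
        (∀ x : geomPoints (W.baseChange K), red (F • x) = φ (φ (red x))) ∧
        (∀ x : geomPoints (W.baseChange K), ((2 ^ M : ℕ) : ℤ) • x = 0 → red x = 0 → x = 0) ∧
        (∀ b : B, φ (φ b) + (l : ℤ) • b = a • φ b) ∧
        (∀ b : B, ∃ y : B, ((2 ^ M : ℕ) : ℤ) • y = b) ∧
        τ₀ ∈ 𝔓.inertia (absoluteGaloisGroup K) ∧
        (∀ τ ∈ 𝔓.inertia (absoluteGaloisGroup K), ∃ i : ℕ, ∀ x ∈ d'.pointsSubgroup,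
          τ • x = (τ₀ ^ i) • x) ∧
        (∃ i : ℕ, ∀ x ∈ d'.pointsSubgroup, F • x = (τ₀ ^ i) • x) ∧
        R₀ ∈ d'.pointsSubgroup ∧
        ((2 ^ M : ℕ) : ℤ) • R₀ = τ₀ • d'.toGeomPoints d'.derivedPoint - d'.toGeomPoints d'.derivedPoint ∧
        red R₀ = l' • φ (red (d.toGeomPoints d.derivedPoint)) - a' • red (d.toGeomPoints d.derivedPoint) ∧
        red (d'.toGeomPoints d'.derivedPoint) = t • φ (red (d.toGeomPoints d.derivedPoint)))
    (j : ℕ) :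
    ((((2 ^ j : ℕ) : ℤ) • d'.kolyvaginClass Nat.prime_two M ∈
          selmerLocalKer (W.baseChange K) (v.adicCompletion K) ((2 ^ M : ℕ) : ℤ) ↔
        ((2 ^ j : ℕ) : ℤ) • d'.kolyvaginClass Nat.prime_two M ∈
          (W.baseChange K).torsionLocalKer (v.adicCompletion K) ((2 ^ M : ℕ) : ℤ)) ∧
      (((2 ^ j : ℕ) : ℤ) • d'.kolyvaginClass Nat.prime_two M ∈
          (W.baseChange K).torsionLocalKer (v.adicCompletion K) ((2 ^ M : ℕ) : ℤ) ↔
        ((2 ^ j : ℕ) : ℤ) • d.kolyvaginClass Nat.prime_two M ∈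
          (W.baseChange K).torsionLocalKer (v.adicCompletion K) ((2 ^ M : ℕ) : ℤ))) := by
  haveI : Fact (Nat.Prime 2) := ⟨Nat.prime_two⟩
  rw [d'.kolyvaginClass_of_admissible Nat.prime_two M hA' hP', d.kolyvaginClass_of_admissible
    Nat.prime_two M hA hP]
  rw [d.kolyvaginClass_of_admissible Nat.prime_two M hA hP] at hsel
  exact zsmul_kolyvaginClass_localOrders_of_zhangKolyvaginPrime W hK hℓ hM hℓv₀ hgood₀ hv hgood hA'
    hA hP' hP hsel hl' ha' hdata _

end AtTwoOrders

end Summit.BirchSwinnertonDyer.BirchSwinnertonDyer.Theorems.GenusExact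

end
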